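import Mathlib
import HarnessLib
import Summits.NavierStokesRegularity.NavierStokesRegularity.Theorems.TaylorModelRungThreeCertificateFormatVEntry

/-!
# Crux K1b-DR (stmt-NavierStokesRegularity-23954), line `taylor-model` — v3 certificate: WINDOW-COORDINATE bridge
# lemmas of the interpreted record (asks of ns-tm-g4 g3 and typer g32, 2026-08-28; successor engine-1 g67)

Three small facts about the interpretation `toCertDataVW / toRadiiW` of a `CertTablesV` record that the G-side
(landing block G4-v) and the readouts checker (F3) consume: (1) `Dsc j` READS THE WINDOW
(`toRadiiW_Dsc_trunc : Dsc j v = Dsc j (trunc cd v)`, true because `Dsc j = linF (diag D_j)` only reads window values);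
(2) window coordinates of `Dsc j ζ` are `D_c·ζ_c` and the faces are AFFINE along `x j 0 + Dsc j ζ`
(`ell_x0_add_Dsc : ℓ_{j,l}(x_{j,0} + Dsc_j ζ) = ℓ_{j,l}(x_{j,0}) + Σ_c φ(w_{l,c})·D_c·ζ_c`); (3) the ENTRY clause in
coordinates (`entry_coords`: every polytope point `q` has a `ζ` with `|ζ_c| ≤ rB_c`, `q_c = yb_c + D_c ζ_c`, and the
affine face formula). MODEL-lattice bookkeeping only (rung TL-M3); nothing here is a statement about the
Navier–Stokes equations.
-/

-- the sub-problem namespace repeats the summit name by design (D-0017)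
set_option linter.dupNamespace false

namespace Summit.NavierStokesRegularity.NavierStokesRegularity.Theorems.TaylorModelCert

open scoped BigOperators
open Literature.Analysis.FluidPDE.TaoCascade Literature.Analysis.FluidPDE.TaoCascade.TaylorChain
open Summit.NavierStokesRegularity.NavierStokesRegularity.Theorems.TaylorModelReadout
open Summit.NavierStokesRegularity.NavierStokesRegularity.Theorems.TaylorModelV

namespace CertTables

variable {K : Type} (T : CertTables K)

/-- Window values ignore truncation to the window. [folklore] -/
theorem wv_trunc_cd (cd : CertData) (hKb : cd.Kb = T.Kb) (hKa : cd.Ka = T.Ka) (y : Fin 4 → ℤ → ℝ) {c : ℕ}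
    (hc : c < T.n) : T.wv (trunc cd y) c = T.wv y c := by
  unfold wv
  rw [trunc_apply, hKb, hKa, if_pos (T.InW_wk hc)]

/-- `linF a` reads the window only: it is blind to truncation of its argument. [folklore] -/
theorem linF_trunc (cd : CertData) (hKb : cd.Kb = T.Kb) (hKa : cd.Ka = T.Ka) (a : ℕ → ℕ → ℝ) (y : Fin 4 → ℤ → ℝ) :
    T.linF a (trunc cd y) = T.linF a y := by
  funext i k
  by_cases hk : -T.Kb ≤ k ∧ k ≤ T.Ka
  · rw [T.linF_apply_of_InW a _ i hk, T.linF_apply_of_InW a _ i hk]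
    exact Finset.sum_congr rfl fun c hc => by rw [T.wv_trunc_cd cd hKb hKa y (Finset.mem_range.1 hc)]
  · rw [T.linF_off a _ i hk, T.linF_off a _ i hk]

end CertTables

namespace CertTablesV

variable (TV : CertTablesV)

/-- **`Dsc` reads the window** (ask of the G-side, G4-v): `Dsc j v = Dsc j (trunc cd v)`. [folklore] -/
theorem toRadiiW_Dsc_trunc (kitOf : ℕ → CoreKit) (wT : ℕ → Array Dyad) (sc : ScalarsV) (j : ℕ) (v : Fin 4 → ℤ → ℝ) :
    (TV.toRadiiW kitOf wT).Dsc j v = (TV.toRadiiW kitOf wT).Dsc j (trunc (TV.toCertDataVW kitOf wT sc) v) := by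
  rw [rd_Dsc, TV.base.linF_trunc _ cd_Kb cd_Ka]

/-- `Dsc j` is blind to truncation, pointfree form. [folklore] -/
theorem toRadiiW_Dsc_comp_trunc (kitOf : ℕ → CoreKit) (wT : ℕ → Array Dyad) (sc : ScalarsV) (j : ℕ) :
    (TV.toRadiiW kitOf wT).Dsc j ∘ trunc (TV.toCertDataVW kitOf wT sc) = (TV.toRadiiW kitOf wT).Dsc j :=
  funext fun v => (TV.toRadiiW_Dsc_trunc kitOf wT sc j v).symm

/-- Window coordinates of `Dsc j ζ`: `D_c · ζ_c`. [folklore] -/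
theorem wv_Dsc (kitOf : ℕ → CoreKit) (wT : ℕ → Array Dyad) (j : ℕ) (ζ : Fin 4 → ℤ → ℝ) {c : ℕ} (hc : c < TV.base.n) :
    TV.base.wv ((TV.toRadiiW kitOf wT).Dsc j ζ) c = vre (TV.stageV j).D c * TV.base.wv ζ c := by
  rw [rd_Dsc, TV.base.wv_linF _ _ hc,
    Finset.sum_congr rfl fun c' hc' => by rw [dre_diagD _ hc (Finset.mem_range.1 hc')]]
  simp only [ite_mul, zero_mul, Finset.sum_ite_eq, Finset.mem_range, if_pos hc]

/-- Window coordinates of the nominal entry point `x j 0 = yb_j`. [folklore] -/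
theorem wv_xR_zero (j : ℕ) {c : ℕ} (hc : c < TV.base.n) : TV.base.wv (TV.xR j 0) c = vre (TV.stageV j).yb c :=
  TV.wv_xR j 0 hc

/-- **Faces are affine along `x j 0 + Dsc j ζ`** (ask of the readouts checker F3):
`ℓ_{j,l}(x_{j,0} + Dsc_j ζ) = ℓ_{j,l}(x_{j,0}) + Σ_c φ(w_{l,c})·(D_c·ζ_c)`. [folklore] -/
theorem ell_x0_add_Dsc (kitOf : ℕ → CoreKit) (wT : ℕ → Array Dyad) (sc : ScalarsV) (j l : ℕ) (ζ : Fin 4 → ℤ → ℝ) :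
    (TV.toCertDataVW kitOf wT sc).ℓ j l (TV.xR j 0 + (TV.toRadiiW kitOf wT).Dsc j ζ) =
      (TV.toCertDataVW kitOf wT sc).ℓ j l (TV.xR j 0) +
        ∑ c ∈ Finset.range TV.base.n, QS2.toRealHom (vget (TV.ellRow j l) c) * (vre (TV.stageV j).D c * TV.base.wv ζ c) := by
  rw [ell_apply_V, ell_apply_V, ← Finset.sum_add_distrib]
  refine Finset.sum_congr rfl fun c hc => ?_
  rw [TV.base.wv_add, TV.wv_Dsc kitOf wT j ζ (Finset.mem_range.1 hc), mul_add]

/-- Faces read the window: `ℓ_{j,l}(q)` depends on the window values of `q` only. [folklore] -/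
theorem ell_congr_wv (kitOf : ℕ → CoreKit) (wT : ℕ → Array Dyad) (sc : ScalarsV) (j l : ℕ) {q q' : Fin 4 → ℤ → ℝ}
    (h : ∀ c < TV.base.n, TV.base.wv q c = TV.base.wv q' c) :
    (TV.toCertDataVW kitOf wT sc).ℓ j l q = (TV.toCertDataVW kitOf wT sc).ℓ j l q' := by
  rw [ell_apply_V, ell_apply_V]
  exact Finset.sum_congr rfl fun c hc => by rw [h c (Finset.mem_range.1 hc)]

/-- **The ENTRY clause in window coordinates** (asks (b)+(c) of the readouts checker F3): under `EntryOK`, every point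
`q` of the entry polytope of stage `j ≤ N₀` has a parameter `ζ` with `|ζ_c| ≤ rB_c`, `q_c = yb_c + D_c·ζ_c` on the
window, and `ℓ_{j,l}(q) = ℓ_{j,l}(x_{j,0}) + Σ_c φ(w_{l,c})·(D_c·ζ_c)` for every face `l`. [folklore] -/
theorem entry_coords (kitOf : ℕ → CoreKit) (wT : ℕ → Array Dyad) (sc : ScalarsV) (hE : EntryOK TV kitOf wT sc)
    {j : ℕ} (hj : j ≤ TV.base.N₀) {q : Fin 4 → ℤ → ℝ} (hq : InPoly (TV.toCertDataVW kitOf wT sc) j q) :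
    ∃ ζ : Fin 4 → ℤ → ℝ,
      (∀ c < TV.base.n, |TV.base.wv ζ c| ≤ vre (TV.stageV j).rB c) ∧
      (∀ c < TV.base.n, TV.base.wv q c = vre (TV.stageV j).yb c + vre (TV.stageV j).D c * TV.base.wv ζ c) ∧
      ∀ l, (TV.toCertDataVW kitOf wT sc).ℓ j l q = (TV.toCertDataVW kitOf wT sc).ℓ j l (TV.xR j 0) +
        ∑ c ∈ Finset.range TV.base.n, QS2.toRealHom (vget (TV.ellRow j l) c) * (vre (TV.stageV j).D c * TV.base.wv ζ c) := by
  obtain ⟨ζ, hζ, hwin⟩ := hE j hj q hq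
  have hw : ∀ c < TV.base.n, TV.base.wv q c = TV.base.wv (TV.xR j 0 + (TV.toRadiiW kitOf wT).Dsc j ζ) c := by
    intro c hc
    have hk := TV.base.InW_wk hc
    exact hwin (TV.base.wi c) (TV.base.wk c) hk.1 hk.2
  refine ⟨ζ, ?_, ?_, fun l => ?_⟩
  · have h := TV.base.absLeVec_of_absLeW cd_Kb cd_Ka (rd_rB (TV := TV) (kitOf := kitOf) (wT := wT) j ▸ hζ)
    exact h
  · intro c hc
    rw [hw c hc, TV.base.wv_add, TV.wv_xR_zero j hc, TV.wv_Dsc kitOf wT j ζ hc]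
  · rw [TV.ell_congr_wv kitOf wT sc j l hw, TV.ell_x0_add_Dsc kitOf wT sc j l ζ]

end CertTablesV

end Summit.NavierStokesRegularity.NavierStokesRegularity.Theorems.TaylorModelCert
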